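import Summits.BirchSwinnertonDyer.Rank1Residual.ManinAdditive.KatoShiftThreeLawsEdges
import HarnessLib

/-!
# DSK refinement g18 — the Kosters–Pannekoek residual K5 of `Ideas/dominant-sign-kato.md` re-routed
# through POLAR INVISIBILITY (tree fact `kato_neron_isIntegral_twistedSymbolSum_of_additive_five_seven_polar`,
# MEMO-es §18.2/§20.2) — typed vocabulary for the note `Ideas/dominant-sign-kato-g18-polar.md`

Crux-ideate r1 seat 2, crux stmt-BirchSwinnertonDyer-25138 `TwistFamilyManinDescent.EisensteinAdditiveManinResidual`.
Sketch only (no route decl is concluded here); two elementary lemmas are PROVED (the mirror-Legendre sign makes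
every odd character non-exceptional), the rest are `Prop`s named for the note. BSD is not proved; Manin `c = 1`
is not proved.
-/

set_option autoImplicit false
set_option linter.dupNamespace false

noncomputable section

open scoped MatrixGroups ModularForm Classical
open CongruenceSubgroup WeierstrassCurve Literature.NumberTheory.EllipticCurves
  Literature.NumberTheory.EllipticCurves.ModularForms
  Summit.BirchSwinnertonDyer.Rank1Residual.ManinAdditive

namespace Summit.BirchSwinnertonDyer.BirchSwinnertonDyer.Cruxes.EisensteinAdditiveManinResidual.DominantSignKatoPolar

/-! ## 1. Mirror-Legendre sign: `(p/ℓ) = −1` puts `−1` in `⟨p⟩ ≤ (ℤ/ℓ)^×`, so NO odd character is trivial at `p` -/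

/-- Euler's criterion, read as: if `p` is a quadratic non-residue modulo the odd prime `ℓ`, then
`p^{(ℓ−1)/2} = −1` in `ZMod ℓ`; in particular `−1 ∈ ⟨p⟩`. -/
theorem pow_div_two_eq_neg_one_of_legendreSym_eq_neg_one {ℓ : ℕ} [Fact ℓ.Prime] (p : ℕ)
    (h : legendreSym ℓ (p : ℤ) = -1) : ((p : ZMod ℓ)) ^ (ℓ / 2) = -1 := by
  have key := legendreSym.eq_pow ℓ (p : ℤ)
  rw [h] at key
  push_cast at key
  exact key.symm

/-- **No odd character is exceptional on the mirror side.** For an odd Dirichlet character `χ` modulo a prime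
`ℓ` with `(p/ℓ) = −1`: `χ(p) ≠ 1` (since `χ(p)^{(ℓ−1)/2} = χ(−1) = −1`). This is the character-side clause (β)
`χ(p) ≠ 1` of the polar fact, obtained for ALL odd `χ` at once by one Legendre condition on the auxiliary prime
(MEMO-es §20.3 «mirror Legendre side»; the `p ∈ {5,7}` sign tables: `p = 5`: `ℓ ≡ ±2 (mod 5)`; `p = 7`,
`ℓ ≡ 3 (mod 4)`: `ℓ ≡ 2, 4 (mod 7)`). -/
theorem oddChar_apply_ne_one_of_legendreSym_eq_neg_one {ℓ : ℕ} [NeZero ℓ] [Fact ℓ.Prime]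
    (χ : DirichletCharacter ℂ ℓ) (hχ : χ.Odd) (p : ℕ) (h : legendreSym ℓ (p : ℤ) = -1) :
    χ (p : ZMod ℓ) ≠ 1 := by
  intro h1
  have hpow : ((p : ZMod ℓ)) ^ (ℓ / 2) = -1 := pow_div_two_eq_neg_one_of_legendreSym_eq_neg_one p h
  have h2 : χ (((p : ZMod ℓ)) ^ (ℓ / 2)) = (χ (p : ZMod ℓ)) ^ (ℓ / 2) := map_pow χ _ _
  rw [hpow, h1, one_pow] at h2
  have h3 : χ (-1) = -1 := hχ
  rw [h3] at h2
  norm_num at h2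

/-- Sanity instances of the sign tables (`decide`): `ℓ = 7, 23` at `p = 5`; `ℓ = 11` at `p = 7`; `ℓ = 7` at `p = 13`. -/
example : (5 : ZMod 7) ^ 3 = -1 := by decide
example : (5 : ZMod 23) ^ 11 = -1 := by decide
example : (7 : ZMod 11) ^ 5 = -1 := by decide
example : (13 : ZMod 7) ^ 3 = -1 := by decide

/-! ## 2. `p`-shift classes and the admissible auxiliary primes of the `+` road with a hole -/

/-- The `p`-SHIFT CLASS `{a/ℓ, pa/ℓ}_f = {0,pa/ℓ}_f − {0,a/ℓ}_f` (the tree's `shiftClass` is the case `p = 3`). -/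
def shiftClassAt (p : ℕ) {N : ℕ} (f : CuspForm (Gamma0 N) 2) (ℓ a : ℕ) : ℂ :=
  primeClass f ℓ (p * a) - primeClass f ℓ a

/-- The subgroup of `ℂ` generated by the `p`-shift classes with `ℓ ∈ S`, `0 < a < ℓ`. -/
def shiftClassSpanAt (p : ℕ) {N : ℕ} (f : CuspForm (Gamma0 N) 2) (S : Set ℕ) : AddSubgroup ℂ :=
  AddSubgroup.closure {z | ∃ ℓ ∈ S, ∃ a : ℕ, 0 < a ∧ a < ℓ ∧ z = shiftClassAt p f ℓ a}

/-- PLUS-ADMISSIBLE auxiliary prime at `(W, N, p)` (the `+` road of the DSK card on a non-resonant row):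
`ℓ ∤ pN` prime, `ℓ ≡ 3 (mod 4)`, `r ∤ ℓ − 1` for every odd prime `r ∣ p − 1` and `p ∤ ℓ − 1` (so every character
mod `ℓ` has order prime to `p` and `ord_ℓ(q)` is prime to `p − 1` up to the Legendre bit), and `(q/ℓ) = +1` at every
multiplicative `q ∥ N` (then `ord_ℓ(q)` is odd: the symmetrised Euler factor is a `p`-unit for every even `χ`
unless `q·a_q ≡ 1 (mod p)`, the resonant case excluded on the `+` road). No condition on `(p/ℓ)`. -/
def PlusAdmissiblePrime (N p ℓ : ℕ) : Prop :=
  ℓ.Prime ∧ ¬ ℓ ∣ p * N ∧ ℓ % 4 = 3 ∧ ¬ p ∣ ℓ - 1 ∧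
    (∀ r : ℕ, r.Prime → r ≠ 2 → r ∣ p - 1 → ¬ r ∣ ℓ - 1) ∧
    ∀ q ∈ N.primeFactors, ¬ q ^ 2 ∣ N → jacobiSym (q : ℤ) ℓ = 1

/-- MIRROR-ADMISSIBLE auxiliary prime (the `−` road on a Kosters–Pannekoek row, `ā = 1`): the tree's `−`-road
conditions with the Legendre bit at `p` FLIPPED to `(p/ℓ) = −1` (§1: every odd `χ` has `χ(p) ≠ 1`), and at the
multiplicative primes the Full-form signs: `(q/ℓ) = −1` if `q·a_q ≡ 1 (mod p)`, `(q/ℓ) = +1` if `q·a_q ≡ −1 (mod p)`. -/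
def MirrorAdmissiblePrime (W : WeierstrassCurve ℚ) [W.IsElliptic] (N p ℓ : ℕ) : Prop :=
  ℓ.Prime ∧ ¬ ℓ ∣ p * N ∧ ℓ % 4 = 3 ∧ ¬ p ∣ ℓ - 1 ∧
    (∀ r : ℕ, r.Prime → r ≠ 2 → r ∣ p - 1 → ¬ r ∣ ℓ - 1) ∧ jacobiSym (p : ℤ) ℓ = -1 ∧
    ∀ q ∈ N.primeFactors, ¬ q ^ 2 ∣ N →
      (((q : ℤ) * W.LFunction q) % p = 1 → jacobiSym (q : ℤ) ℓ = -1) ∧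
      (((q : ℤ) * W.LFunction q) % p = p - 1 → jacobiSym (q : ℤ) ℓ = 1)

/-- `dia_p(N) = 0`: no prime `q ∣ N` with `q ≡ 1 (mod p)` and `p³ ∤ N` — the levels at which the narrow-Eisenstein
DIAMOND span `𝒟_N ⊆ H¹(X₀(N), 𝔽_p)` vanishes (MEMO-es §18.4/§21; E21-SHIFTP: annihilator of the `p`-shift
classes has dimension `dia_p(N)` at all 68 levels `25k ≤ 1000`, `49k ≤ 980`, `9k ≤ 99`). -/
def DiaZero (N p : ℕ) : Prop :=
  (∀ q ∈ N.primeFactors, q % p ≠ 1) ∧ ¬ p ^ 3 ∣ N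

/-- **(G⁺_p) `p`-shift generation at dia-zero levels** (LAW-CANDIDATE, `f`-free in spirit; data E21-SHIFTP for the
full prime family, kit j333747 for the plus-admissible family at `N ∈ {50,75,325,1200,2800}` (`p = 5`), `882`
(`p = 7`)): at a level `N` with `p² ∣ N` and `dia_p(N) = 0`, for every `ℓ₀` the plus-admissible `p`-shift classes
with `ℓ ≥ ℓ₀` generate `Λ_f` up to an index prime to `p`, for EVERY weight-2 newform `f` of level `N` — Eisenstein
or not (at `dia_p(N) = 0` there is no diamond functional to hide behind). -/
def PlusShiftGenerationDiaZero (p : ℕ) : Prop :=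
  ∀ (W : WeierstrassCurve ℚ) [W.IsElliptic] {N : ℕ} [NeZero N] (f : CuspForm (Gamma0 N) 2) (ℓ₀ : ℕ),
    IsNewformOf W f → p ^ 2 ∣ N → DiaZero N p →
    ∃ m : ℕ, ¬ p ∣ m ∧ ∀ z ∈ periodLattice f,
      (m : ℂ) * z ∈ shiftClassSpanAt p f {ℓ | ℓ₀ ≤ ℓ ∧ PlusAdmissiblePrime N p ℓ}

/-- **The hole congruence** (output of the `+` road's even orthogonality WITH A HOLE at `⟨p, −1⟩`, fed by the
dominant-sign Kato–Néron inequality K1⁺ with the polar clause): on a `+`-dominant Kosters–Pannekoek row,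
`p ∣ c₀` forces every plus-admissible `p`-shift class to have real part in `p·ℤ·(Ω⁺-unit)`. Stated abstractly over a
real coordinate `x : ℂ → ℤ`-like functional as the divisibility of the shift periods' real coordinates. -/
def PlusHoleCongruence (p : ℕ) {N : ℕ} (f : CuspForm (Gamma0 N) 2) (u : ℝ) (ℓ₀ : ℕ) : Prop :=
  ∀ ℓ, ℓ₀ ≤ ℓ → PlusAdmissiblePrime N p ℓ → ∀ a : ℕ, 0 < a → a < ℓ →
    ∃ k : ℤ, (shiftClassAt p f ℓ a).re = p * k * u

/-- **Punchline shape** (elementary, the analogue of es §17.2(e)): if the real coordinate (in units `u > 0` with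
`Re Λ_f = ℤ·u`) of every plus-admissible `p`-shift class is divisible by `p`, while those classes generate `Λ_f` up to
an index prime to `p`, contradiction. Recorded as an implication `Prop` for the note (proof = bookkeeping). -/
def PlusPunchline (p : ℕ) : Prop :=
  ∀ {N : ℕ} (f : CuspForm (Gamma0 N) 2) (u : ℝ) (ℓ₀ m : ℕ), 0 < u → ¬ p ∣ m →
    (∀ z ∈ periodLattice f, ∃ k : ℤ, z.re = k * u) → (∃ z ∈ periodLattice f, z.re = u) →
    (∀ z ∈ periodLattice f, (m : ℂ) * z ∈ shiftClassSpanAt p f {ℓ | ℓ₀ ≤ ℓ ∧ PlusAdmissiblePrime N p ℓ}) →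
    ¬ PlusHoleCongruence p f u ℓ₀

/-- **The punchline is a theorem** (pure bookkeeping, no number theory): proof of `PlusPunchline p`. -/
theorem plusPunchline_holds (p : ℕ) : PlusPunchline p := by
  intro N f u ℓ₀ m hu hm hlat hz hspan hhole
  obtain ⟨z₀, hz₀, hz₀re⟩ := hz
  let S : AddSubgroup ℂ :=
    { carrier := {w | ∃ k : ℤ, w.re = p * k * u}
      zero_mem' := ⟨0, by simp⟩
      add_mem' := by
        rintro a b ⟨k1, hk1⟩ ⟨k2, hk2⟩
        exact ⟨k1 + k2, by rw [Complex.add_re, hk1, hk2]; push_cast; ring⟩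
      neg_mem' := by
        rintro a ⟨k, hk⟩
        exact ⟨-k, by rw [Complex.neg_re, hk]; push_cast; ring⟩ }
  have hsub : shiftClassSpanAt p f {ℓ | ℓ₀ ≤ ℓ ∧ PlusAdmissiblePrime N p ℓ} ≤ S := by
    refine (AddSubgroup.closure_le S).mpr ?_
    rintro w ⟨ℓ, ⟨hℓ₀, hadm⟩, a, ha0, haℓ, rfl⟩
    exact hhole ℓ hℓ₀ hadm a ha0 haℓ
  have hmz : ∃ k : ℤ, ((m : ℂ) * z₀).re = p * k * u := hsub (hspan z₀ hz₀)
  obtain ⟨k, hk⟩ := hmz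
  have hre : ((m : ℂ) * z₀).re = m * u := by simp [Complex.mul_re, hz₀re]
  rw [hre] at hk
  have hmu : (m : ℝ) = p * k := mul_right_cancel₀ (ne_of_gt hu) hk
  have hint : (m : ℤ) = p * k := by exact_mod_cast hmu
  exact hm (Int.natCast_dvd_natCast.mp ⟨k, hint⟩)

end Summit.BirchSwinnertonDyer.BirchSwinnertonDyer.Cruxes.EisensteinAdditiveManinResidual.DominantSignKatoPolar
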